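/-
Copyright (c) 2026 the pub-hodgecm-mathlib formalisation cell (harness21).  Prover seat hodgecm-mathlib-K2E1-p13 (g4), Track B ∕ K2-LIT, h413 = `stmt-HodgeConjecture-24833`,
R90-TF section S8 «ContSpec-n½», #4′ road, deal S8-R26 (H3) ∕ S8-R27 (3) ∕ LETTER SHAPE RULE S8-R29 (2) of R90-CS-plan (g2): the block-structure letter (E_blk) of ★ p862113
`R90S8ResHLeClosureCharLinesOfLetters` — a `χ`-block of pseudo-Eisenstein series is exhausted by its atoms and its lines — in the regime «lines := the block ⊖ its atoms» (census
`R90/S8/CENSUS-Eblk.K2E1-p13-g4.md` R1), generic in the level datum `(K′, ω)`, Mathlib-only on top of the ★ block bytes.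
-/
import Summits.HodgeConjecture.HodgeConjecture.Theorems.K2E1PseudoEisensteinFamilyDecompositionOpenCosetsU2    -- ★ C7 HEAD″ p861008: the block bytes (`chiSectionSpace`, `eisensteinSeriesU`, `borelHeight`, `quasiSplit`)
import Summits.HodgeConjecture.HodgeConjecture.Theorems.R90S8ResHBlockDataU2Defs                             -- ★ p862464 (K2E1-p15, ED. 2): the DEFS OF RECORD `resHBlock` ∕ `resHAtom` ∕ `resHLine` (regime R1)
import HarnessLib

/-!
# S8 #4′ road — `R90S8PseudoEisensteinBlocksDenseU2`: the letter (E_blk) «`Blk_χ^{(K′,ω)} ≤ closure (At ⊔ Ln)`» of ★ `residual_le_topologicalClosure_iSup_charLines_of_letters` (p862113),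
# for ANY atom space `At ≤ Blk` and the lines `Ln := Blk ⊓ Atᗮ` (regime R1), at an ARBITRARY level datum `(K′ : Subgroup U(J₂)(𝔸), ω : K′ →* ℂ)` and block character `χ`

Track B ∕ K2-LIT, crux h413 = `stmt-HodgeConjecture-24833`, route of record `HCCMUnconditional`; cell `hodgecm-mathlib`, R90-TF programme, section S8 «ContSpec-n½», socket #4′
`sock_S8_resH_spannedByCharLines` of `Lines/R90_S8_ResidualSpectrumU3B.lean`.  THEOREMS ONLY (no `def`, no `instance`, no `notation`, no named-fact hypothesis, no `sorry`; default
heartbeats); lane `--supports stmt-HodgeConjecture-24833 --as helper` (count-neutral).  CLOSES NO SOCKET: it pays ONE letter of the LAYER 2 PRINT ★ p862113 (`hEblk`, :84–88), pointwise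
in the index and generic in the level datum (S8-R29 (2)); the assembly H7 instantiates it at the index family of record `fun ℓ b => … (K' ℓ) (ω ℓ) (b : HeckeCharacter L)`.

THE MATHEMATICS ([MoeglinWaldspurger1995] II.2.4, VI.2; [Langlands1976] §7; rank one [Rogawski1990] §13.9 p. 229).  Fix the CM pair `L∕L⁺`, `G = U(J₂) = quasiSplit L⁺ L c 2`, a level datum
`(K′, ω)` and a Hecke character `χ`.  The BLOCK `Blk = Blk_χ^{(K′,ω)}` is the closed span in `L²(G(L⁺)∖G(𝔸), μ)` of the C⁰-bricks `[E(f(H)·φ)]` (`f ∈ C_c((0,∞))`, `φ ∈ V(χ, K′, ω)`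
continuous) — the `Blk χ` bytes of ★ C7 HEAD″ `blocks_open`.  Spectrally `Blk = (⊕_{c} Res_c) ⊕ 𝓜^{cont}` (residues of `E(φ, z)` at the finitely many real poles `c ∈ (½, 1]` ⊕ the
unitary-axis wave packets) [MW95 VI.2]; the #4′ road only needs the EXHAUSTION «`Blk ≤ closure (At ⊔ Ln)`» for an atom space `At ≤ Blk` and a line space `Ln`, and in the regime of record
R1 (census §1; R90-C133-p02's (N-iface) holds by definition there) the line space is DEFINED as the block's orthocomplement of its atoms, `Ln := Blk ⊓ Atᗮ`.  Then (E_blk) is Hilbert-space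
algebra: for `H` complete, `K ≤ H` closed and `A ≤ K` ANY submodule, `K = Ā ⊕ (K ⊓ Āᗮ)` (orthogonal projection onto the complete `Ā ≤ K`) and `Āᗮ = Aᗮ`, so `K ≤ closure (A ⊔ (K ⊓ Aᗮ))`
(§1, no finite-dimensionality of `A` needed); §2 prints it on the block bytes.  HONEST SCOPE: the identification of `Blk ⊓ Atᗮ` with the closure of the unitary-axis wave packets [MW95 VI.2]
(= the RANGE SPLITTING of the block's Plancherel isometry, census §2) is NOT claimed here and is not needed by #4′; under a model-keyed `Ln` (regime R2) this file's §2 is the reduction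
and the range-splitting letter would stay visible (census §2 says so).

* §1 ABSTRACT (Mathlib-only): `isOrtho_inf_orthogonal` (`A ⟂ K ⊓ Aᗮ`), `inf_orthogonal_le` (`K ⊓ Aᗮ ≤ K`), **`le_topologicalClosure_sup_inf_orthogonal`** (`K` closed, `A ≤ K` ⇒
  `K ≤ closure (A ⊔ (K ⊓ Aᗮ))`), `topologicalClosure_sup_inf_orthogonal_eq` (in fact `=`).
* §2 PRINT at `quasiSplit L⁺ L c 2`: **`pseudoEisensteinBlock_le_closure_atoms_sup_lines`** — `hEblk`'s clause at `(K′, ω, χ)` for ANY `At ≤ Blk` with `Ln := Blk ⊓ Atᗮ` spelled out;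
  `pseudoEisensteinBlock_atoms_isOrtho_lines` (the in-block half of (O), free); `pseudoEisensteinBlock_lines_le` (`Ln ≤ Blk`).
HONEST LABEL: HC_CM is proved only modulo the 7 printed citations (2 remaining named inputs: hLiu418 = `stmt-HodgeConjecture-24832`, h413 = `stmt-HodgeConjecture-24833`) until rung 0
closes; REL ≠ ★ ≠ BUILT; this file asserts no named fact and closes no socket; count-neutral.

## References
* [MoeglinWaldspurger1995] C. Mœglin, J.-L. Waldspurger, *Spectral Decomposition and Eisenstein Series* (1995), II.2.4, V.3.13, VI.2.
* [Langlands1976] R. P. Langlands, *On the Functional Equations Satisfied by Eisenstein Series*, LNM 544 (1976), §7.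
* [Rogawski1990] J. D. Rogawski, *Automorphic Representations of Unitary Groups in Three Variables* (1990), §13.9 p. 229.
* [ReedSimonI1980] M. Reed, B. Simon, *Methods of Modern Mathematical Physics I* (1980), Thm. II.3 (projection theorem).
-/

set_option autoImplicit false
set_option linter.dupNamespace false  -- the mandated namespace `…HodgeConjecture.HodgeConjecture.R90.S8` (LEAD #1 L1) repeats the summit's segment

noncomputable section

open MeasureTheory Measure Set Filter Topology NumberField
open Literature.NumberTheory.Automorphic Literature.NumberTheory.Automorphic.UnitaryGroup Literature.NumberTheory.GaloisRepresentations AdelicGroupData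
open Summit.HodgeConjecture.HodgeConjecture.Cruxes.H413.K2E1BorelEisensteinU
open Summit.HodgeConjecture.HodgeConjecture.Cruxes.H413.K2E1CharacterEisensteinU2Defs
open Summit.HodgeConjecture.HodgeConjecture.Cruxes.H413.K2E1ChiSectionSpaceU2Defs
open scoped ENNReal NNReal

namespace Summit.HodgeConjecture.HodgeConjecture.R90.S8

/-! ## §1 Abstract: a closed subspace is exhausted by any subspace of it and the relative orthocomplement -/

section Abstract

variable {H : Type*} [NormedAddCommGroup H] [InnerProductSpace ℂ H]

/-- **`A ⟂ K ⊓ Aᗮ`** — the atoms are orthogonal to the lines of the same block when the lines are the relative orthocomplement (the in-block half of (O), free). [folklore] -/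
theorem isOrtho_inf_orthogonal (A K : Submodule ℂ H) : A ⟂ (K ⊓ Aᗮ) :=
  (Submodule.isOrtho_orthogonal_right A).mono_right inf_le_right

/-- `K ⊓ Aᗮ ≤ K` — the lines lie in the block. [folklore] -/
theorem inf_orthogonal_le (A K : Submodule ℂ H) : K ⊓ Aᗮ ≤ K := inf_le_left

/-- **A CLOSED SUBSPACE IS EXHAUSTED BY ANY SUBSPACE OF IT AND THE RELATIVE ORTHOCOMPLEMENT**: for `H` complete, `K` closed and `A ≤ K` (any submodule, closed or not),
`K ≤ closure (A ⊔ (K ⊓ Aᗮ))`.  Proof: `Ā ≤ K` is complete, so `x = P_Ā x + (x − P_Ā x)` with `P_Ā x ∈ Ā ≤ closure (A ⊔ …)` and `x − P_Ā x ∈ K ⊓ Āᗮ ≤ K ⊓ Aᗮ`.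
[cite: ReedSimonI1980, Thm. II.3] [cite: MoeglinWaldspurger1995, VI.2] -/
theorem le_topologicalClosure_sup_inf_orthogonal [CompleteSpace H] (K : Submodule ℂ H) (hK : IsClosed (K : Set H)) (A : Submodule ℂ H) (hA : A ≤ K) :
    K ≤ (A ⊔ (K ⊓ Aᗮ)).topologicalClosure := by
  intro x hx
  haveI : CompleteSpace A.topologicalClosure := A.isClosed_topologicalClosure.completeSpace_coe
  haveI : A.topologicalClosure.HasOrthogonalProjection := Submodule.HasOrthogonalProjection.ofCompleteSpace _
  have hAcK : A.topologicalClosure ≤ K := A.topologicalClosure_minimal hA hK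
  -- the two pieces
  have h1 : A.topologicalClosure.starProjection x ∈ (A ⊔ (K ⊓ Aᗮ)).topologicalClosure :=
    Submodule.topologicalClosure_mono le_sup_left (A.topologicalClosure.starProjection_apply_mem x)
  have h2 : x - A.topologicalClosure.starProjection x ∈ K ⊓ Aᗮ :=
    ⟨K.sub_mem hx (hAcK (A.topologicalClosure.starProjection_apply_mem x)),
      Submodule.orthogonal_le A.le_topologicalClosure (A.topologicalClosure.sub_starProjection_mem_orthogonal x)⟩
  have h2' : x - A.topologicalClosure.starProjection x ∈ (A ⊔ (K ⊓ Aᗮ)).topologicalClosure :=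
    Submodule.le_topologicalClosure _ (Submodule.mem_sup_right h2)
  simpa using Submodule.add_mem _ h1 h2'

/-- **… IN FACT WITH EQUALITY**: `closure (A ⊔ (K ⊓ Aᗮ)) = K` for `K` closed and `A ≤ K`. [cite: ReedSimonI1980, Thm. II.3] -/
theorem topologicalClosure_sup_inf_orthogonal_eq [CompleteSpace H] (K : Submodule ℂ H) (hK : IsClosed (K : Set H)) (A : Submodule ℂ H) (hA : A ≤ K) :
    (A ⊔ (K ⊓ Aᗮ)).topologicalClosure = K :=
  le_antisymm (Submodule.topologicalClosure_minimal _ (sup_le hA inf_le_left) hK) (le_topologicalClosure_sup_inf_orthogonal K hK A hA)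

end Abstract

/-! ## §2 The print on the block bytes of ★ p862113 ∕ ★ C7 HEAD″ `blocks_open` at `G = quasiSplit L⁺ L c 2` -/

variable (L : Type) [Field L] [NumberField L] [IsCMField L]
  (μ : Measure (quasiSplit (↥(maximalRealSubfield L)) L (IsCMField.complexConj L) 2).automorphicQuotient)

/-- **(E_blk) IN REGIME R1 — THE `χ`-BLOCK OF PSEUDO-EISENSTEIN SERIES AT LEVEL `(K′, ω)` IS EXHAUSTED BY ITS ATOMS AND ITS LINES**: for ANY level datum `(K′, ω)`, ANY Hecke character
`χ`, and ANY atom space `At ≤ Blk := closure span {[E(f(H)·φ)] : f ∈ C_c((0,∞)), φ ∈ V(χ, K′, ω) continuous}` (the `hEblk` ∕ `blocks_open` block bytes), with the lines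
`Ln := Blk ⊓ Atᗮ`:  `Blk ≤ closure (At ⊔ Ln)` — the clause `hEblk ℓ b` of ★ `residual_le_topologicalClosure_iSup_charLines_of_letters` at `(K′ ℓ, ω ℓ, b)`.  No side condition of the
level datum is used. [cite: MoeglinWaldspurger1995, II.2.4, VI.2] [cite: Langlands1976, §7] [cite: Rogawski1990, §13.9 p. 229] -/
theorem pseudoEisensteinBlock_le_closure_atoms_sup_lines (K' : Subgroup (quasiSplit (↥(maximalRealSubfield L)) L (IsCMField.complexConj L) 2).Adelic) (ω : ↥K' →* ℂ) (χ : HeckeCharacter L)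
    (At : Submodule ℂ ((quasiSplit (↥(maximalRealSubfield L)) L (IsCMField.complexConj L) 2).L2 μ))
    (hAt : At ≤ (Submodule.span ℂ {v : (quasiSplit (↥(maximalRealSubfield L)) L (IsCMField.complexConj L) 2).L2 μ |
            ∃ (f : ℝ → ℂ) (_ : Continuous f) (_ : HasCompactSupport f) (_ : tsupport f ⊆ Ioi 0)
              (φ : (quasiSplit (↥(maximalRealSubfield L)) L (IsCMField.complexConj L) 2).Adelic → ℂ) (_ : φ ∈ chiSectionSpace χ K' (ω : ↥K' → ℂ)) (_ : Continuous φ)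
              (hv : MemLp ((quasiSplit (↥(maximalRealSubfield L)) L (IsCMField.complexConj L) 2).quotFun (eisensteinSeriesU (fun g => f (borelHeight g) * φ g))) 2 μ), v = hv.toLp _}).topologicalClosure) :
    (Submodule.span ℂ {v : (quasiSplit (↥(maximalRealSubfield L)) L (IsCMField.complexConj L) 2).L2 μ |
            ∃ (f : ℝ → ℂ) (_ : Continuous f) (_ : HasCompactSupport f) (_ : tsupport f ⊆ Ioi 0)
              (φ : (quasiSplit (↥(maximalRealSubfield L)) L (IsCMField.complexConj L) 2).Adelic → ℂ) (_ : φ ∈ chiSectionSpace χ K' (ω : ↥K' → ℂ)) (_ : Continuous φ)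
              (hv : MemLp ((quasiSplit (↥(maximalRealSubfield L)) L (IsCMField.complexConj L) 2).quotFun (eisensteinSeriesU (fun g => f (borelHeight g) * φ g))) 2 μ), v = hv.toLp _}).topologicalClosure ≤
      (At ⊔ ((Submodule.span ℂ {v : (quasiSplit (↥(maximalRealSubfield L)) L (IsCMField.complexConj L) 2).L2 μ |
            ∃ (f : ℝ → ℂ) (_ : Continuous f) (_ : HasCompactSupport f) (_ : tsupport f ⊆ Ioi 0)
              (φ : (quasiSplit (↥(maximalRealSubfield L)) L (IsCMField.complexConj L) 2).Adelic → ℂ) (_ : φ ∈ chiSectionSpace χ K' (ω : ↥K' → ℂ)) (_ : Continuous φ)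
              (hv : MemLp ((quasiSplit (↥(maximalRealSubfield L)) L (IsCMField.complexConj L) 2).quotFun (eisensteinSeriesU (fun g => f (borelHeight g) * φ g))) 2 μ), v = hv.toLp _}).topologicalClosure ⊓ Atᗮ)).topologicalClosure :=
  le_topologicalClosure_sup_inf_orthogonal _ (Submodule.isClosed_topologicalClosure _) At hAt

/-- **The in-block half of (O), free in regime R1**: `At ⟂ Ln` for `Ln := Blk ⊓ Atᗮ` (any `At`, any block). [folklore] -/
theorem pseudoEisensteinBlock_atoms_isOrtho_lines (K' : Subgroup (quasiSplit (↥(maximalRealSubfield L)) L (IsCMField.complexConj L) 2).Adelic) (ω : ↥K' →* ℂ) (χ : HeckeCharacter L)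
    (At : Submodule ℂ ((quasiSplit (↥(maximalRealSubfield L)) L (IsCMField.complexConj L) 2).L2 μ)) :
    At ⟂ ((Submodule.span ℂ {v : (quasiSplit (↥(maximalRealSubfield L)) L (IsCMField.complexConj L) 2).L2 μ |
            ∃ (f : ℝ → ℂ) (_ : Continuous f) (_ : HasCompactSupport f) (_ : tsupport f ⊆ Ioi 0)
              (φ : (quasiSplit (↥(maximalRealSubfield L)) L (IsCMField.complexConj L) 2).Adelic → ℂ) (_ : φ ∈ chiSectionSpace χ K' (ω : ↥K' → ℂ)) (_ : Continuous φ)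
              (hv : MemLp ((quasiSplit (↥(maximalRealSubfield L)) L (IsCMField.complexConj L) 2).quotFun (eisensteinSeriesU (fun g => f (borelHeight g) * φ g))) 2 μ), v = hv.toLp _}).topologicalClosure ⊓ Atᗮ) :=
  isOrtho_inf_orthogonal At _

/-- **The lines lie in the block**: `Ln := Blk ⊓ Atᗮ ≤ Blk`. [folklore] -/
theorem pseudoEisensteinBlock_lines_le (K' : Subgroup (quasiSplit (↥(maximalRealSubfield L)) L (IsCMField.complexConj L) 2).Adelic) (ω : ↥K' →* ℂ) (χ : HeckeCharacter L)
    (At : Submodule ℂ ((quasiSplit (↥(maximalRealSubfield L)) L (IsCMField.complexConj L) 2).L2 μ)) :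
    (Submodule.span ℂ {v : (quasiSplit (↥(maximalRealSubfield L)) L (IsCMField.complexConj L) 2).L2 μ |
            ∃ (f : ℝ → ℂ) (_ : Continuous f) (_ : HasCompactSupport f) (_ : tsupport f ⊆ Ioi 0)
              (φ : (quasiSplit (↥(maximalRealSubfield L)) L (IsCMField.complexConj L) 2).Adelic → ℂ) (_ : φ ∈ chiSectionSpace χ K' (ω : ↥K' → ℂ)) (_ : Continuous φ)
              (hv : MemLp ((quasiSplit (↥(maximalRealSubfield L)) L (IsCMField.complexConj L) 2).quotFun (eisensteinSeriesU (fun g => f (borelHeight g) * φ g))) 2 μ), v = hv.toLp _}).topologicalClosure ⊓ Atᗮ ≤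
      (Submodule.span ℂ {v : (quasiSplit (↥(maximalRealSubfield L)) L (IsCMField.complexConj L) 2).L2 μ |
            ∃ (f : ℝ → ℂ) (_ : Continuous f) (_ : HasCompactSupport f) (_ : tsupport f ⊆ Ioi 0)
              (φ : (quasiSplit (↥(maximalRealSubfield L)) L (IsCMField.complexConj L) 2).Adelic → ℂ) (_ : φ ∈ chiSectionSpace χ K' (ω : ↥K' → ℂ)) (_ : Continuous φ)
              (hv : MemLp ((quasiSplit (↥(maximalRealSubfield L)) L (IsCMField.complexConj L) 2).quotFun (eisensteinSeriesU (fun g => f (borelHeight g) * φ g))) 2 μ), v = hv.toLp _}).topologicalClosure :=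
  inf_le_left

/-! ## §3 (ED. 2) BY NAME at the defs of record ★ `R90S8ResHBlockDataU2Defs` (K2E1-p15, regime R1): `resHBlock ≤ closure (resHAtom U ⊔ resHLine U)` for EVERY block-model map `U` -/

section ByName

variable {A Λ : Type*} [AddCommGroup A] [Module ℂ A] [AddCommGroup Λ] [Module ℂ Λ]

/-- **(E_blk) BY NAME (ED. 2)**: for ANY block-model coordinate map `U : L² →ₗ[ℂ] A × Λ` (atoms × line; D5′ currency `U_b = U_SD ∘ P_{Sc}`), ANY level datum `(K′, ω)` and ANY `χ`,
`resHBlock L μ K′ ω χ ≤ closure (resHAtom L μ U K′ ω χ ⊔ resHLine L μ U K′ ω χ)` — the clause `hEblk ℓ b` of ★ p862113 at `At := fun ℓ b => resHAtom L μ (U ℓ b) (K' ℓ) (ω ℓ) ↑b`,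
`Ln := fun ℓ b => resHLine L μ (U ℓ b) (K' ℓ) (ω ℓ) ↑b` (its left side IS `resHBlock L μ (K' ℓ) (ω ℓ) ↑b` by ★ `resHBlock_def`, `rfl`).  §1 at `K := resHBlock` (★ `isClosed_resHBlock`),
`A := resHAtom U ≤ K` (★ `resHAtom_le_resHBlock`); `resHLine U = resHBlock ⊓ (resHAtom U)ᗮ` by definition (D3).  No side condition of the level datum, no letter of the model.
[cite: MoeglinWaldspurger1995, II.2.4, VI.2] [cite: Langlands1976, §7] -/
theorem resHBlock_le_topologicalClosure_resHAtom_sup_resHLine (U : (quasiSplit (↥(maximalRealSubfield L)) L (IsCMField.complexConj L) 2).L2 μ →ₗ[ℂ] A × Λ)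
    (K' : Subgroup (quasiSplit (↥(maximalRealSubfield L)) L (IsCMField.complexConj L) 2).Adelic) (ω : ↥K' →* ℂ) (χ : HeckeCharacter L) :
    resHBlock L μ K' ω χ ≤ (resHAtom L μ U K' ω χ ⊔ resHLine L μ U K' ω χ).topologicalClosure :=
  le_topologicalClosure_sup_inf_orthogonal _ (isClosed_resHBlock L μ K' ω χ) _ (resHAtom_le_resHBlock L μ U K' ω χ)

/-- **… with equality**: `closure (resHAtom U ⊔ resHLine U) = resHBlock`. [cite: MoeglinWaldspurger1995, VI.2] -/
theorem topologicalClosure_resHAtom_sup_resHLine_eq (U : (quasiSplit (↥(maximalRealSubfield L)) L (IsCMField.complexConj L) 2).L2 μ →ₗ[ℂ] A × Λ)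
    (K' : Subgroup (quasiSplit (↥(maximalRealSubfield L)) L (IsCMField.complexConj L) 2).Adelic) (ω : ↥K' →* ℂ) (χ : HeckeCharacter L) :
    (resHAtom L μ U K' ω χ ⊔ resHLine L μ U K' ω χ).topologicalClosure = resHBlock L μ K' ω χ :=
  topologicalClosure_sup_inf_orthogonal_eq _ (isClosed_resHBlock L μ K' ω χ) _ (resHAtom_le_resHBlock L μ U K' ω χ)

end ByName

/-- **THE PRINT'S `hEblk` BINDER, VERBATIM, AT THE DEFS OF RECORD (ED. 2)** — for an index family `K' : ι → Subgroup`, `ω ℓ : K' ℓ →* ℂ` and ANY family of block-model maps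
`U ℓ b : L² →ₗ[ℂ] A ℓ b × Λ ℓ b` on the print's block index `b : {χ ∕∕ χ|_{ℝ>0} = 1 ∧ V(χ, K' ℓ, ω ℓ) ≠ ⊥}`: the letter (E_blk) of ★ `residual_le_topologicalClosure_iSup_charLines_of_letters` with
`At := fun ℓ b => resHAtom L μ (U ℓ b) (K' ℓ) (ω ℓ) ↑b`, `Ln := fun ℓ b => resHLine L μ (U ℓ b) (K' ℓ) (ω ℓ) ↑b` — ONE term for the assembly H7. [cite: MoeglinWaldspurger1995, II.2.4, VI.2] -/
theorem hEblk_resHAtom_resHLine {ι : Type*} (K' : ι → Subgroup (quasiSplit (↥(maximalRealSubfield L)) L (IsCMField.complexConj L) 2).Adelic) (ω : ∀ ℓ : ι, ↥(K' ℓ) →* ℂ)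
    {A Λ : ∀ ℓ : ι, ↥{χ : HeckeCharacter L | (∀ r : ℝ≥0ˣ, χ (posRealIdele L r) = 1) ∧ chiSectionSpace χ (K' ℓ) (ω ℓ : ↥(K' ℓ) → ℂ) ≠ ⊥} → Type*}
    [∀ ℓ b, AddCommGroup (A ℓ b)] [∀ ℓ b, Module ℂ (A ℓ b)] [∀ ℓ b, AddCommGroup (Λ ℓ b)] [∀ ℓ b, Module ℂ (Λ ℓ b)]
    (U : ∀ (ℓ : ι) (b : ↥{χ : HeckeCharacter L | (∀ r : ℝ≥0ˣ, χ (posRealIdele L r) = 1) ∧ chiSectionSpace χ (K' ℓ) (ω ℓ : ↥(K' ℓ) → ℂ) ≠ ⊥}), (quasiSplit (↥(maximalRealSubfield L)) L (IsCMField.complexConj L) 2).L2 μ →ₗ[ℂ] A ℓ b × Λ ℓ b) :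
    ∀ (ℓ : ι) (b : ↥{χ : HeckeCharacter L | (∀ r : ℝ≥0ˣ, χ (posRealIdele L r) = 1) ∧ chiSectionSpace χ (K' ℓ) (ω ℓ : ↥(K' ℓ) → ℂ) ≠ ⊥}),
      (Submodule.span ℂ {v : (quasiSplit (↥(maximalRealSubfield L)) L (IsCMField.complexConj L) 2).L2 μ |
            ∃ (f : ℝ → ℂ) (_ : Continuous f) (_ : HasCompactSupport f) (_ : tsupport f ⊆ Ioi 0)
              (φ : (quasiSplit (↥(maximalRealSubfield L)) L (IsCMField.complexConj L) 2).Adelic → ℂ) (_ : φ ∈ chiSectionSpace (b : HeckeCharacter L) (K' ℓ) (ω ℓ : ↥(K' ℓ) → ℂ)) (_ : Continuous φ)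
              (hv : MemLp ((quasiSplit (↥(maximalRealSubfield L)) L (IsCMField.complexConj L) 2).quotFun (eisensteinSeriesU (fun g => f (borelHeight g) * φ g))) 2 μ), v = hv.toLp _}).topologicalClosure ≤
        (resHAtom L μ (U ℓ b) (K' ℓ) (ω ℓ) (b : HeckeCharacter L) ⊔ resHLine L μ (U ℓ b) (K' ℓ) (ω ℓ) (b : HeckeCharacter L)).topologicalClosure :=
  fun ℓ b => resHBlock_le_topologicalClosure_resHAtom_sup_resHLine L μ (U ℓ b) (K' ℓ) (ω ℓ) (b : HeckeCharacter L)

end Summit.HodgeConjecture.HodgeConjecture.R90.S8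

end
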